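import Mathlib
import Literature.Computability.Complexity.RandomKSatEnsembleOGP
import Summits.PneNP.PneNP.Theorems.OverlapGapAlgebraSearchHardWindowChainMassBasic

/-!
# Route OverlapGapAlgebra, crux `SearchHardWindow` (stmt-PneNP-2460): the one-step instability
# bound of the `ε`-resampling chain (Markov on top of `L²`-stability)

Instances of random `k`-SAT are literal arrays; the resampling chain lives on the UNCURRIED space
`S = (Fin m × Fin k → Fin n × Bool)` with the `ε`-resampling kernel
`P_ε(y, y') = ∏_i ((1 − ε)·[y i = y' i] + ε/|Γ|)`
(`Literature.Computability.Complexity.resampleKernel`), and a (low-degree) algorithm outputs the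
real vector `F (curry y) : Fin n → ℝ`.

`stub_instability` (Huang–Sellke 2025, arXiv:2501.06427 §3.3, the Markov step of the proof of
Cor. 3.21): if every output coordinate is `L²`-stable under the kernel,
`Σ_{y,y'} P_ε(y,y') (F_v y − F_v y')² ≤ 2ε(1 + ε·#(Fin m × Fin k))·D·Σ_y F_v y²` (hypothesis
`hStab`, the landed `stub_resampleStability` instantiated), and the energy is bounded,
`Σ_Φ Σ_v F Φ v² ≤ C·n·#Φ` (hypothesis `hener`, over the CURRIED instance space), then the kernel
mass of the pairs `(y, y')` whose outputs move by MORE than `θ·n` in squared Euclidean norm is at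
most `(2ε(1 + ε m k) D C / θ)·#S`.

Proof: pointwise Markov `[s > θ n] ≤ s/(θ n)` for `s = Σ_v (F_v y − F_v y')² ≥ 0` against the
nonnegative kernel weights (`cmb_kernel_nonneg` of the landed chain-mass module
`OverlapGapAlgebraSearchHardWindowChainMassBasic`, and `ins_indicator_le`); swap the sums
(`Finset.sum_comm`), apply `hStab` coordinatewise, reindex the energy along the currying bijection
`Equiv.curry` (`Fintype.sum_equiv`, `Fintype.card_congr`), apply `hener`, and simplify
`#(Fin m × Fin k) = m k`, `(1/(θ n))·(C n #S) = (C/θ)·#S`.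
-/

set_option linter.dupNamespace false -- `Summit.PneNP.PneNP.…`: summit = sub-problem

namespace Summit.PneNP.PneNP.Theorems

open Finset
open Literature.Computability.Complexity
open scoped Classical

/-- Pointwise Markov: the indicator of `s > t` is at most `s / t` for `s ≥ 0`, `t > 0`. -/
theorem ins_indicator_le {s t : ℝ} [Decidable (s ≤ t)] (hs : 0 ≤ s) (ht : 0 < t) :
    (if s ≤ t then (0 : ℝ) else 1) ≤ s / t := by
  split_ifs with h
  · exact div_nonneg hs ht.le
  · exact (one_le_div ht).2 (not_le.1 h).le

/-- **One-step instability bound of the resampling chain** (Markov on top of the `L²`-stability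
`hStab` of each output coordinate; Huang–Sellke 2025, arXiv:2501.06427 §3.3): for a vector-valued
`F` on literal arrays with energy `Σ_Φ Σ_v F Φ v² ≤ C n #Φ`, the kernel mass of the pairs `(y, y')`
whose outputs move by more than `θ n` in squared Euclidean norm is
`≤ (2ε(1 + ε m k) D C / θ) · #(Fin m × Fin k → Fin n × Bool)`. -/
theorem stub_instability (n m k : ℕ) (hn : 1 ≤ n) (ε θ C : ℝ) (hε0 : 0 ≤ ε) (hε1 : ε ≤ 1)
    (hθ : 0 < θ) (D : ℕ) (F : (Fin m → Fin k → Fin n × Bool) → Fin n → ℝ)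
    (hener : ∑ Φ : Fin m → Fin k → Fin n × Bool, ∑ v : Fin n, F Φ v ^ 2
      ≤ C * n * Fintype.card (Fin m → Fin k → Fin n × Bool))
    (hStab : ∀ v : Fin n,
      ∑ y : Fin m × Fin k → Fin n × Bool, ∑ y' : Fin m × Fin k → Fin n × Bool,
          resampleKernel ε y y' * (F (Function.curry y) v - F (Function.curry y') v) ^ 2
        ≤ 2 * ε * (1 + ε * Fintype.card (Fin m × Fin k)) * D *
            ∑ y : Fin m × Fin k → Fin n × Bool, F (Function.curry y) v ^ 2) :
    ∑ y : Fin m × Fin k → Fin n × Bool, ∑ y' : Fin m × Fin k → Fin n × Bool,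
        resampleKernel ε y y' *
          (if ∑ v, (F (Function.curry y) v - F (Function.curry y') v) ^ 2 ≤ θ * n then (0 : ℝ)
            else 1)
      ≤ 2 * ε * (1 + ε * (m * k)) * D * C / θ * Fintype.card (Fin m × Fin k → Fin n × Bool) := by
  -- the denominators are positive
  have hn' : (0 : ℝ) < n := by exact_mod_cast hn
  have hθn : 0 < θ * n := mul_pos hθ hn'
  -- `#(Fin m × Fin k) = m k`, and currying is a bijection between the two instance spaces
  have hmk : (Fintype.card (Fin m × Fin k) : ℝ) = m * k := by
    rw [Fintype.card_prod, Fintype.card_fin, Fintype.card_fin, Nat.cast_mul]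
  have hcard : (Fintype.card (Fin m → Fin k → Fin n × Bool) : ℝ) =
      Fintype.card (Fin m × Fin k → Fin n × Bool) := by
    exact_mod_cast (Fintype.card_congr (Equiv.curry (Fin m) (Fin k) (Fin n × Bool))).symm
  -- the energy bound, transported to the uncurried instance space
  have hener' : ∑ y : Fin m × Fin k → Fin n × Bool, ∑ v : Fin n, F (Function.curry y) v ^ 2 ≤
      C * n * Fintype.card (Fin m × Fin k → Fin n × Bool) := by
    rw [← hcard, Fintype.sum_equiv (Equiv.curry (Fin m) (Fin k) (Fin n × Bool))
      (fun y => ∑ v : Fin n, F (Function.curry y) v ^ 2) (fun Φ => ∑ v : Fin n, F Φ v ^ 2)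
      (fun y => rfl)]
    exact hener
  calc ∑ y : Fin m × Fin k → Fin n × Bool, ∑ y' : Fin m × Fin k → Fin n × Bool,
        resampleKernel ε y y' *
          (if ∑ v, (F (Function.curry y) v - F (Function.curry y') v) ^ 2 ≤ θ * n then (0 : ℝ)
            else 1)
      ≤ ∑ y : Fin m × Fin k → Fin n × Bool, ∑ y' : Fin m × Fin k → Fin n × Bool,
          resampleKernel ε y y' *
            ((∑ v, (F (Function.curry y) v - F (Function.curry y') v) ^ 2) / (θ * n)) :=
        -- pointwise Markov against the nonnegative kernel weights
        Finset.sum_le_sum fun y _ => Finset.sum_le_sum fun y' _ =>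
          mul_le_mul_of_nonneg_left
            (ins_indicator_le (Finset.sum_nonneg fun v _ => sq_nonneg _) hθn)
            (cmb_kernel_nonneg ε hε0 hε1 y y')
    _ = ∑ v : Fin n, (∑ y : Fin m × Fin k → Fin n × Bool, ∑ y' : Fin m × Fin k → Fin n × Bool,
          resampleKernel ε y y' * (F (Function.curry y) v - F (Function.curry y') v) ^ 2) /
            (θ * n) := by
        -- distribute and swap the order of summation
        simp only [Finset.sum_div, Finset.mul_sum, mul_div_assoc]
        exact (Finset.sum_congr rfl fun y _ => Finset.sum_comm).trans Finset.sum_comm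
    _ ≤ ∑ v : Fin n, (2 * ε * (1 + ε * Fintype.card (Fin m × Fin k)) * D *
          ∑ y : Fin m × Fin k → Fin n × Bool, F (Function.curry y) v ^ 2) / (θ * n) :=
        -- `L²`-stability of each output coordinate
        Finset.sum_le_sum fun v _ => div_le_div_of_nonneg_right (hStab v) hθn.le
    _ = ∑ v : Fin n, (2 * ε * (1 + ε * Fintype.card (Fin m × Fin k)) * D / (θ * n)) *
          ∑ y : Fin m × Fin k → Fin n × Bool, F (Function.curry y) v ^ 2 :=
        Finset.sum_congr rfl fun v _ => by ring
    _ = (2 * ε * (1 + ε * Fintype.card (Fin m × Fin k)) * D / (θ * n)) *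
          ∑ y : Fin m × Fin k → Fin n × Bool, ∑ v : Fin n, F (Function.curry y) v ^ 2 := by
        rw [← Finset.mul_sum, Finset.sum_comm]
    _ ≤ (2 * ε * (1 + ε * Fintype.card (Fin m × Fin k)) * D / (θ * n)) *
          (C * n * Fintype.card (Fin m × Fin k → Fin n × Bool)) :=
        -- the energy bound, against the nonnegative constant
        mul_le_mul_of_nonneg_left hener' (by positivity)
    _ = 2 * ε * (1 + ε * (m * k)) * D * C / θ * Fintype.card (Fin m × Fin k → Fin n × Bool) := by
        rw [hmk]
        field_simp

end Summit.PneNP.PneNP.Theorems
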